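import Literature.Computability.AlgebraicComplexity.BorderComplexityZariski
import Literature.Computability.AlgebraicComplexity.ApproxComplexityProjections
import Literature.Computability.AlgebraicComplexity.ZariskiClosureLaurentPoints
import Literature.Computability.AlgebraicComplexity.CircuitCount
import HarnessLib

/-!
# Alder's theorem for circuits: the Zariski closure of a size class consists of border
# computations (Bürgisser 2024 survey, Thm. 4.20; Bürgisser 2004, Thm. 2.2 / Thm. 5.7; Alder 1984) — PROVED

Topic `Computability/AlgebraicComplexity`. Cell `val-lit`, row Bur2024-A (Bürgisser's 2024 survey
*Completeness classes in algebraic complexity theory*, arXiv:2406.06217), §4.7 "Closures of complexity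
classes". The survey defines the border complexity `L̲(f)` TOPOLOGICALLY (Def. 4.18: `{f | L̲(f) ≤ s}`
is the Zariski closure of `{f | L(f) ≤ s}`; Thm. 4.19: over `ℂ` the Euclidean closure gives the same
notion) and then states the ALGEBRAIC characterisation:

> **Theorem 4.20** (Alder [alde:84]; see also [ACT]). Let `f ∈ 𝔽[x₁,…,xₙ]`. The border complexity
> `L̲(f)` of `f` is the smallest natural number `s` such that there exists `F` in `R[x₁,…,xₙ]`
> satisfying `F_{ε=0} = f` and `L(F) ≤ s`. Here the complexity `L` is to be interpreted with respect
> to the larger field of constants `𝔽(ε)` [`R ⊆ 𝔽(ε)` the rational functions defined at `ε = 0`;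
> "one may equivalently consider the local ring `𝔽[[ε]]`"]. (held text `paper:arxiv-2406.06217`,
> p0021 L35–L42; Def. 4.18 = p0021 L1–L5, Thm. 4.19 = p0021 L12–L15.)

The tree carries BOTH renderings of `L̲`, in two files written for different consumers:
`approxComplexity` (`BLMW11KroneckerApproximation.lean`, BLMW 2011 Def. 9.3.1: `coeffVec f` in the
Zariski closure of the coefficient vectors of `{g | L(g) ≤ r}`, over `ℂ`) and `borderComplexity`
(`ApproximativeRootClosure.lean`, Bürgisser 2004 Def. 2.1 / CKRST 2020 Def. 1.12: a fan-in-two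
circuit over `F((ε))` computing `f + O(ε)`). `BorderComplexityZariski.lean` proves the "easy"
inclusion `approxComplexity ≤ borderComplexity` and records that the converse — Alder's theorem,
Bürgisser 2004 Thm. 2.2 = Thm. 5.7 — was NOT formalised. This file proves it:

* `borderComplexity_le_of_coeffVec_mem_zariskiClosure` — over every ALGEBRAICALLY CLOSED field `K`:
  if `coeffVec f ∈ zariskiClosure (coeffVec '' {g | complexity g ≤ r})` then `borderComplexity f ≤ r`;
* `borderComplexity_le_iff_coeffVec_mem_zariskiClosure` — Thm. 4.20 as an `iff` (with the easy
  inclusion of `BorderComplexityZariski.lean`), i.e. `{f | L̲_ε(f) ≤ r}` IS the Zariski closure of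
  `{f | L(f) ≤ r}` in coefficient space (Bürgisser 2004, Thm. 2.2);
* over `ℂ`: `borderComplexity_le_approxComplexity`, **`approxComplexity_eq_borderComplexity`**
  (the two renderings coincide) and `isVPBarFamily_iff_isPBounded_borderComplexity`
  (Def. 4.23: BLMW's `\overline{VP}` = Bürgisser's `\underline{VP}` as classes of families).

## Proof (Bürgisser 2004 §5.3, Thm. 5.7, after BCS Lemma (20.28); the tree's pieces)

1. **Generic computations.** By `CircuitCount.exists_code_eval_eq` every fan-in-two circuit of size
   `≤ r` over `K` and variables `σ` is, up to its value, the decoding of a syntactic code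
   `c : CircuitCount.Code K σ r`. Replacing the (at most `4r + 1`) constants of a code by slot
   indeterminates gives the GENERIC code `genCode K sh` over `A = K[Y_slot]` of the shape
   `sh : Code Unit σ r`, and `c` is recovered by evaluating the slots at the constants of `c`
   (`mapConsts_genCode_shape`). Hence (`exists_shape_eval_eq`) the size class `{g | L(g) ≤ r}` is
   covered by the images of the FINITELY many polynomial maps
   `a ↦ (decode (genCode K sh)).eval (Y ↦ a)` (Bürgisser's `φ_Γ`, B04 §5.3).
2. **Irreducible components.** The Zariski closure of a finite union is contained in the union of
   the closures (`zariskiClosure_iUnion_subset`: product of test polynomials), so `coeffVec f` lies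
   in the closure of ONE image.
3. **Curve selection.** On the finite set `τ` of monomials occurring in `f` or in the generic
   polynomial `G_sh`, closure membership is the kernel condition `ker (P^*) ≤ 𝔪_f` for the
   coefficient polynomials `P_t ∈ A`, and the tree's Laurent form of BCS Lemma (20.28)
   (`LaurentPoints.exists_laurentSeries_of_ker_le`, file `ZariskiClosureLaurentPoints.lean`) gives a
   `K`-algebra map `Ψ : A → K((ε))` with `Ψ(P_t) ∈ K[[ε]]` of constant coefficient `f_t`.
4. **The border computation.** The generic circuit with constants `Ψ(Y_slot) ∈ K((ε))` has size `r`
   and computes `Ψ(G_sh) = f + O(ε)` coefficientwise, whence `borderComplexity f ≤ r`.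

Deviation from print: Bürgisser 2004 obtains in addition the order bound `L̲(f)` computations with
`ε`-order `≤ 2^{L̲(f)²}` via Lehmkuhl–Lickteig; no order bound is asserted here (none is part of
Thm. 4.20). Theorems plus plumbing definitions with bodies (`CircuitCount.OpCode/GateCode/Code.mapConsts`,
`Slot`, `genOp`/`genGate`/`genCode`, `OpCode.constOf`, `constsOf`, `shape`); 0 named facts, no
instances, no notation. Honest framing: a 1984/2004 theorem re-proved; nothing here bears on
`VP` versus `\overline{VP}` versus `VNP` (open), and `VP ≠ VNP` is NOT proved.

## References

* [Burgisser2024Completeness] P. Bürgisser, *Completeness classes in algebraic complexity theory*,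
  arXiv:2406.06217 (2024), §4.7: Def. 4.18, Thm. 4.19, Thm. 4.20, Def. 4.23 (held text p0021).
* [Burgisser2004Factors] P. Bürgisser, *The complexity of factors of multivariate polynomials*,
  Found. Comput. Math. 4 (2004) 369–396 = arXiv:1812.06828, Def. 2.1, Thm. 2.2, §5.3, Thm. 5.7.
* [BurgisserClausenShokrollahi1997] P. Bürgisser, M. Clausen, M. A. Shokrollahi, *Algebraic
  Complexity Theory*, Springer 1997, Lemma (20.28) ([ACT] of the survey).
* [BurgisserEtAl2011] Bürgisser–Landsberg–Manivel–Weyman, SIAM J. Comput. 40 (2011), Def. 9.3.1.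
* A. Alder, *Grenzrang und Grenzkomplexität aus algebraischer und topologischer Sicht*, PhD thesis,
  Zürich 1984 ([alde:84] of the survey; not held, cited through the survey).
-/

noncomputable section

open MvPolynomial

namespace Literature.Computability.AlgebraicComplexity

universe u u' v

/-! ### §1. Zariski closure of a finite union -/

section Zariski

variable {k : Type*} [Field k] {ι : Type*}

/-- **Finite unions of algebraic sets are algebraic** (Hartshorne I, Prop. 1.1: "if `Y₁ = Z(T₁)`
and `Y₂ = Z(T₂)` then `Y₁ ∪ Y₂ = Z(T₁T₂)`"), in closure form: the Zariski closure of a finite union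
is contained in the union of the Zariski closures (if `x ∉ \overline{A_i}` for all `i`, the product
of the separating test polynomials separates `x` from `⋃ A_i`). Stated for the tree's
`zariskiClosure` on an affine space `ι → k` with an arbitrary (possibly infinite) index set `ι`.
[cite: Hartshorne1977, I Prop. 1.1] -/
theorem zariskiClosure_iUnion_subset {α : Type*} [Finite α] (A : α → Set (ι → k)) :
    zariskiClosure (⋃ i, A i) ⊆ ⋃ i, zariskiClosure (A i) := by
  classical
  intro x hx
  by_contra hnot
  simp only [Set.mem_iUnion, not_exists] at hnot
  have hsep : ∀ i, ∃ p : MvPolynomial ι k, (∀ y ∈ A i, aeval y p = 0) ∧ aeval x p ≠ 0 := by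
    intro i
    have hi := hnot i
    rw [mem_zariskiClosure_iff] at hi
    push Not at hi
    exact hi
  choose p hp0 hpx using hsep
  haveI := Fintype.ofFinite α
  rw [mem_zariskiClosure_iff] at hx
  have h := hx (∏ i, p i) fun y hy => by
    obtain ⟨i, hi⟩ := Set.mem_iUnion.mp hy
    rw [map_prod]
    exact Finset.prod_eq_zero (Finset.mem_univ i) (hp0 i y hi)
  rw [map_prod] at h
  exact Finset.prod_ne_zero_iff.mpr (fun i _ => hpx i) h

end Zariski

/-! ### §2. Generic computations: codes with indeterminate constants (Bürgisser 2004, §5.3) -/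

namespace CircuitCount

variable {k : Type u} {k' : Type u'} {σ : Type v} {s : ℕ}

/-- Change of constants in an operand code. [cite: Burgisser2004Factors, §5.3 (generic computations)] -/
def OpCode.mapConsts (φ : k → k') : OpCode k σ s → OpCode k' σ s :=
  Sum.map id (Sum.map φ id)

/-- Change of constants in a gate code. [cite: Burgisser2004Factors, §5.3 (generic computations)] -/
def GateCode.mapConsts (φ : k → k') (g : GateCode k σ s) : GateCode k' σ s :=
  (g.1, φ g.2.1, OpCode.mapConsts φ g.2.2.1, φ g.2.2.2.1, OpCode.mapConsts φ g.2.2.2.2)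

/-- Change of constants in a circuit code. [cite: Burgisser2004Factors, §5.3 (generic computations)] -/
def Code.mapConsts (φ : k → k') (c : Code k σ s) : Code k' σ s :=
  (fun i => GateCode.mapConsts φ (c.1 i), OpCode.mapConsts φ c.2)

/-- Composition of changes of constants (operands). [cite: Burgisser2004Factors, §5.3] -/
theorem OpCode.mapConsts_mapConsts {k'' : Type*} (φ : k → k') (ψ : k' → k'') (o : OpCode k σ s) :
    OpCode.mapConsts ψ (OpCode.mapConsts φ o) = OpCode.mapConsts (ψ ∘ φ) o := by
  rcases o with i | c | j <;> rfl

/-- Decoding commutes with a change of constants (operands). [cite: Burgisser2004Factors, §5.3] -/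
theorem decOp_mapConsts (φ : k → k') (o : OpCode k σ s) :
    decOp (OpCode.mapConsts φ o) = (decOp o).map φ := by
  rcases o with i | c | j <;> rfl

/-- Decoding commutes with a change of constants (gates). [cite: Burgisser2004Factors, §5.3] -/
theorem decGate_mapConsts (φ : k → k') (g : GateCode k σ s) :
    decGate (GateCode.mapConsts φ g) = (decGate g).map φ := by
  obtain ⟨b, c₁, o₁, c₂, o₂⟩ := g
  cases b <;>
    simp [GateCode.mapConsts, decGate, ArithCircuit.Gate.map, decOp_mapConsts]

/-- Decoding commutes with a change of constants (circuits). [cite: Burgisser2004Factors, §5.3] -/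
theorem decode_mapConsts (φ : k → k') (c : Code k σ s) :
    decode (Code.mapConsts φ c) = (decode c).mapConsts φ := by
  simp only [decode, Code.mapConsts, ArithCircuit.mapConsts, List.map_ofFn]
  congr 1
  · congr 1
    funext i
    exact decGate_mapConsts φ (c.1 i)
  · exact decOp_mapConsts φ c.2

/-- A decoded code is a fan-in-two circuit. [cite: ChatterjeeKumarRamyaSaptharishiTengse2020, Claim 3.10 (arXiv v4), proof] -/
theorem isFanInTwo_decode (c : Code k σ s) : (decode c).IsFanInTwo := by
  intro g hg
  simp only [decode, List.mem_map, List.mem_ofFn] at hg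
  obtain ⟨gc, _, rfl⟩ := hg
  obtain ⟨b, c₁, o₁, c₂, o₂⟩ := gc
  cases b <;> simp [decGate, ArithCircuit.Gate.fanIn, ArithCircuit.Gate.args]

/-- A decoded code has exactly `s` gates. [cite: ChatterjeeKumarRamyaSaptharishiTengse2020, Claim 3.10 (arXiv v4), proof] -/
theorem size_decode (c : Code k σ s) : (decode c).size = s := by
  simp [decode, ArithCircuit.size]

/-- The constant slots of a code with `s` gates: four per gate (the two coefficients and the two
possible constant operands of `c₁ • o₁ + c₂ • o₂` / `o₁ * o₂`) and one for the output operand.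
[cite: Burgisser2004Factors, §5.3 (generic computations)] -/
abbrev Slot (s : ℕ) : Type := (Fin s × Fin 4) ⊕ Unit

section Generic

variable (K : Type u) [CommSemiring K]

/-- The generic operand of a shape at slot `x`: a constant operand becomes the indeterminate `Y_x`.
[cite: Burgisser2004Factors, §5.3 (generic computations)] -/
def genOp (x : Slot s) (o : OpCode Unit σ s) : OpCode (MvPolynomial (Slot s) K) σ s :=
  OpCode.mapConsts (fun _ => (X x : MvPolynomial (Slot s) K)) o

/-- The generic gate of a shape in position `i`: coefficients `Y_{(i,0)}`, `Y_{(i,2)}`, constant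
operands `Y_{(i,1)}`, `Y_{(i,3)}`. [cite: Burgisser2004Factors, §5.3 (generic computations)] -/
def genGate (i : Fin s) (g : GateCode Unit σ s) : GateCode (MvPolynomial (Slot s) K) σ s :=
  (g.1, X (Sum.inl (i, 0)), genOp K (Sum.inl (i, 1)) g.2.2.1, X (Sum.inl (i, 2)),
    genOp K (Sum.inl (i, 3)) g.2.2.2.2)

/-- **The generic computation of a shape** (Bürgisser 2004 §5.3, "generic computation `Γ`" with
indeterminate constants): the code over `K[Y_slot]` whose constants are the slot indeterminates.
[cite: Burgisser2004Factors, §5.3 (generic computations)] -/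
def genCode (sh : Code Unit σ s) : Code (MvPolynomial (Slot s) K) σ s :=
  (fun i => genGate K i (sh.1 i), genOp K (Sum.inr ()) sh.2)

variable {K}

/-- The constant carried by an operand code (`0` if it is not a constant). [cite: Burgisser2004Factors, §5.3] -/
def OpCode.constOf : OpCode K σ s → K
  | Sum.inr (Sum.inl c) => c
  | _ => 0

/-- The constants of a code, read off slot by slot. [cite: Burgisser2004Factors, §5.3] -/
def constsOf (c : Code K σ s) : Slot s → K
  | Sum.inl (i, j) =>
      ![(c.1 i).2.1, OpCode.constOf (c.1 i).2.2.1, (c.1 i).2.2.2.1, OpCode.constOf (c.1 i).2.2.2.2] j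
  | Sum.inr _ => OpCode.constOf c.2

/-- The shape of a code: forget the constants. [cite: Burgisser2004Factors, §5.3] -/
def shape (c : Code K σ s) : Code Unit σ s :=
  Code.mapConsts (fun _ => ()) c

/-- An operand code is recovered by putting back its own constant. [cite: Burgisser2004Factors, §5.3] -/
theorem OpCode.mapConsts_constOf (o : OpCode K σ s) :
    OpCode.mapConsts (fun _ : K => OpCode.constOf o) o = o := by
  rcases o with i | c | j <;> rfl

/-- Evaluating the generic operand of the shape of `o` at the constant of `o` gives back `o`.
[cite: Burgisser2004Factors, §5.3 (specialisation of generic computations)] -/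
theorem OpCode.mapConsts_eval_genOp (o : OpCode K σ s) (x : Slot s) (a : Slot s → K)
    (ha : a x = OpCode.constOf o) :
    OpCode.mapConsts (fun p => MvPolynomial.eval a p)
      (genOp K x (OpCode.mapConsts (fun _ => ()) o)) = o := by
  rw [genOp, OpCode.mapConsts_mapConsts, OpCode.mapConsts_mapConsts]
  convert OpCode.mapConsts_constOf o using 2
  funext c
  simp [ha]

/-- **Specialisation of the generic computation**: evaluating the slot indeterminates of the generic
code of the shape of `c` at the constants of `c` gives back `c`.
[cite: Burgisser2004Factors, §5.3 (specialisation of generic computations)] -/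
theorem mapConsts_genCode_shape (c : Code K σ s) :
    Code.mapConsts (fun p => MvPolynomial.eval (constsOf c) p) (genCode K (shape c)) = c := by
  obtain ⟨cg, co⟩ := c
  simp only [Code.mapConsts, genCode, shape]
  refine Prod.ext ?_ ?_
  · funext i
    rcases hci : cg i with ⟨b, c₁, o₁, c₂, o₂⟩
    simp only [GateCode.mapConsts, genGate, hci]
    refine Prod.ext rfl (Prod.ext ?_ (Prod.ext ?_ (Prod.ext ?_ ?_)))
    · simp [constsOf, hci]
    · exact OpCode.mapConsts_eval_genOp o₁ _ _ (by simp [constsOf, hci])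
    · simp [constsOf, hci]
    · exact OpCode.mapConsts_eval_genOp o₂ _ _ (by simp [constsOf, hci])
  · exact OpCode.mapConsts_eval_genOp co _ _ (by simp [constsOf])

/-- The decoded generic circuit specialises to the decoded circuit. [cite: Burgisser2004Factors, §5.3] -/
theorem map_decode_genCode_shape (c : Code K σ s) :
    (decode (genCode K (shape c))).map (MvPolynomial.eval (constsOf c)) = decode c := by
  conv_rhs => rw [← mapConsts_genCode_shape c]
  rw [decode_mapConsts]
  rfl

/-- The value of a decoded circuit is the specialisation of the value of the generic circuit of
its shape. [cite: Burgisser2004Factors, §5.3 (`φ_Γ`)] -/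
theorem eval_decode_eq_map_eval_genCode (c : Code K σ s) :
    (decode c).eval =
      MvPolynomial.map (MvPolynomial.eval (constsOf c)) (decode (genCode K (shape c))).eval := by
  rw [← ArithCircuit.eval_map_apply, map_decode_genCode_shape]

variable (K)

/-- **The size class is covered by finitely many polynomial images** (Bürgisser 2004 §5.3:
`{f | L(f) ≤ r} = ⋃_Γ im φ_Γ` over the generic computations `Γ` of length `r`): every `f` with
`complexity f ≤ r` is the specialisation, at some point `a ∈ K^{Slot r}`, of the polynomial
computed by the generic circuit of some shape. [cite: Burgisser2004Factors, §5.3] -/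
theorem exists_shape_eval_eq {f : MvPolynomial σ K} {r : ℕ} (hf : complexity f ≤ r) :
    ∃ (sh : Code Unit σ r) (a : Slot r → K),
      MvPolynomial.map (MvPolynomial.eval a) (decode (genCode K sh)).eval = f := by
  obtain ⟨P, h2, hP, hs⟩ := ArithCircuit.exists_computes_size_eq_complexity f
  obtain ⟨c, hc⟩ := exists_code_eval_eq P h2 (hs ▸ hf)
  refine ⟨shape c, constsOf c, ?_⟩
  rw [← eval_decode_eq_map_eval_genCode, hc]
  exact hP

end Generic

end CircuitCount

/-! ### §3. Alder's theorem (Bürgisser 2024 Thm. 4.20; Bürgisser 2004 Thm. 2.2 / 5.7) -/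

section Alder

open CircuitCount

variable {K : Type u} [Field K]

/-- A power series minus its constant coefficient is `O(ε)` in `K((ε))`. [folklore] -/
private theorem isOrdGE_one_coe_sub_C (q : PowerSeries K) :
    IsOrdGE 1 ((q : LaurentSeries K) - HahnSeries.C (PowerSeries.constantCoeff q)) := by
  intro i hi
  rw [HahnSeries.coeff_sub, PowerSeries.coeff_coe, HahnSeries.C_apply]
  by_cases h0 : i = 0
  · subst h0
    simp
  · have hneg : i < 0 := lt_of_le_of_ne (by omega) h0
    rw [if_pos hneg, HahnSeries.coeff_single_of_ne h0, sub_zero]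

variable [IsAlgClosed K] {σ : Type v} [Fintype σ] [DecidableEq σ]

/-- **Alder's theorem for circuits / Bürgisser 2004, Thm. 2.2 (= Thm. 5.7), the hard inclusion;
Bürgisser 2024 survey, Thm. 4.20** — over an algebraically closed field `K`: if the coefficient
vector of `f ∈ K[x_σ]` lies in the Zariski closure of the coefficient vectors of the polynomials
`g` of fan-in-two circuit size `L(g) ≤ r`, then `f` has a border computation of size `≤ r` over
`K((ε))`, i.e. `L̲(f) = borderComplexity f ≤ r` ("`L̲(f)` is the smallest `s` such that there exists
`F` in `R[x₁,…,xₙ]` satisfying `F_{ε=0} = f` and `L(F) ≤ s`", survey p0021 L35–L42; B04: "the set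
`{f | L̲(f) ≤ r}` is the Zariski closure of `{f | L(f) ≤ r}`"). Proof: module docstring (generic
computations, closure of a finite union, the Laurent curve lemma BCS (20.28)).
[cite: Burgisser2024Completeness, Thm. 4.20 (§4.7, p0021 L35–L42)] [cite: Burgisser2004Factors, Thm. 2.2; Thm. 5.7] [cite: BurgisserClausenShokrollahi1997, Lemma (20.28)] -/
theorem borderComplexity_le_of_coeffVec_mem_zariskiClosure (f : MvPolynomial σ K) {r : ℕ}
    (hf : coeffVec f ∈ zariskiClosure (coeffVec '' {g : MvPolynomial σ K | complexity g ≤ r})) :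
    borderComplexity f ≤ r := by
  classical
  -- §1: the size class is covered by the images of the generic computations of the shapes
  let G : Code Unit σ r → MvPolynomial σ (MvPolynomial (Slot r) K) :=
    fun sh => (decode (genCode K sh)).eval
  let Φ : Code Unit σ r → (Slot r → K) → MvPolynomial σ K :=
    fun sh a => MvPolynomial.map (MvPolynomial.eval a) (G sh)
  have hcover : coeffVec '' {g : MvPolynomial σ K | complexity g ≤ r} ⊆
      ⋃ sh, coeffVec '' Set.range (Φ sh) := by
    rintro _ ⟨g, hg, rfl⟩
    obtain ⟨sh, a, ha⟩ := exists_shape_eval_eq K hg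
    exact Set.mem_iUnion.mpr ⟨sh, g, ⟨a, ha⟩, rfl⟩
  -- §2: `coeffVec f` lies in the closure of ONE image
  obtain ⟨sh, hsh⟩ := Set.mem_iUnion.mp
    (zariskiClosure_iUnion_subset _ (zariskiClosure_mono hcover hf))
  -- §3: the kernel condition on the finitely many monomials that occur
  let S : Finset (σ →₀ ℕ) := (G sh).support ∪ f.support
  let P : S → MvPolynomial (Slot r) K := fun t => coeff (t : σ →₀ ℕ) (G sh)
  have hker : RingHom.ker (aeval P : MvPolynomial S K →ₐ[K] MvPolynomial (Slot r) K) ≤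
      RingHom.ker (aeval (fun t : S => coeff (t : σ →₀ ℕ) f) : MvPolynomial S K →ₐ[K] K) := by
    intro Q hQ
    rw [RingHom.mem_ker] at hQ ⊢
    have hvan : ∀ y ∈ coeffVec '' Set.range (Φ sh),
        aeval y (rename (fun t : S => (t : σ →₀ ℕ)) Q) = 0 := by
      rintro _ ⟨_, ⟨a, rfl⟩, rfl⟩
      rw [aeval_rename]
      have hfun : (coeffVec (Φ sh a) ∘ fun t : S => (t : σ →₀ ℕ)) =
          fun t => aeval a (P t) := by
        funext t
        simp only [Function.comp_apply, coeffVec_apply, Φ, coeff_map, P]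
        rfl
      rw [hfun, ← comp_aeval, AlgHom.comp_apply, hQ, map_zero]
    have h0 := (mem_zariskiClosure_iff.mp hsh) _ hvan
    rwa [aeval_rename] at h0
  -- the Laurent point (BCS Lemma (20.28), Laurent form)
  obtain ⟨Ψ, hΨ⟩ := LaurentPoints.exists_laurentSeries_of_ker_le P hker
  -- §4: the border computation: the generic circuit with constants `Ψ(Y)`
  let C : ArithCircuit (LaurentSeries K) σ :=
    (decode (genCode K sh)).map (Ψ : MvPolynomial (Slot r) K →+* LaurentSeries K)
  have hCeval : C.eval = MvPolynomial.map (Ψ : MvPolynomial (Slot r) K →+* LaurentSeries K) (G sh) :=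
    ArithCircuit.eval_map_apply _ _
  have hcx : complexity C.eval ≤ r := by
    have h := ArithCircuit.complexity_le_size ((isFanInTwo_decode (genCode K sh)).map
      (Ψ : MvPolynomial (Slot r) K →+* LaurentSeries K)) (rfl : C.Computes C.eval)
    rwa [ArithCircuit.size_map, size_decode] at h
  refine (borderComplexity_le_of_polyOrdGE C.eval fun m => ?_).trans hcx
  rw [coeff_sub, coeff_map, hCeval, coeff_map, algebraMap_laurentSeries_apply]
  by_cases hm : m ∈ S
  · obtain ⟨q, hq, hq0⟩ := hΨ ⟨m, hm⟩
    change IsOrdGE 1 (Ψ (P ⟨m, hm⟩) - HahnSeries.C (coeff m f))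
    rw [hq, ← hq0]
    exact isOrdGE_one_coe_sub_C q
  · have hm' : m ∉ (G sh).support ∧ m ∉ f.support := by
      simpa only [S, Finset.mem_union, not_or] using hm
    rw [notMem_support_iff.mp hm'.1, notMem_support_iff.mp hm'.2, map_zero, map_zero, sub_zero]
    exact IsOrdGE.zero 1

/-- **Bürgisser 2004, Thm. 2.2 / Bürgisser 2024, Def. 4.18 + Thm. 4.20 as an equivalence**: over an
algebraically closed field, `L̲(f) ≤ r` (a border computation of size `≤ r` over `K((ε))`) iff the
coefficient vector of `f` lies in the Zariski closure of `{g | L(g) ≤ r}` — "the set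
`{f ∈ A_n | L̲(f) ≤ r}` is the Zariski closure of the set `{f ∈ A_n | L(f) ≤ r}`". The direction `→`
is `BorderComplexityZariski.coeffVec_mem_zariskiClosure_of_borderComplexity_le` (any infinite field).
[cite: Burgisser2004Factors, Thm. 2.2] [cite: Burgisser2024Completeness, Def. 4.18 and Thm. 4.20 (§4.7, p0021)] -/
theorem borderComplexity_le_iff_coeffVec_mem_zariskiClosure (f : MvPolynomial σ K) (r : ℕ) :
    borderComplexity f ≤ r ↔
      coeffVec f ∈ zariskiClosure (coeffVec '' {g : MvPolynomial σ K | complexity g ≤ r}) :=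
  ⟨coeffVec_mem_zariskiClosure_of_borderComplexity_le f,
    borderComplexity_le_of_coeffVec_mem_zariskiClosure f⟩

end Alder

/-! ### §4. Over `ℂ`: the two renderings of `L̲` coincide (Bürgisser 2024 Thms. 4.19–4.20) -/

section Complex

variable {σ : Type*} [Fintype σ] [DecidableEq σ]

/-- **`borderComplexity f ≤ approxComplexity f` over `ℂ`** (Alder; Bürgisser 2004 Thm. 2.2, the
inclusion `\overline{{L ≤ r}} ⊆ {L̲ ≤ r}`; BLMW 2011, remark after Def. 9.3.1).
[cite: Burgisser2024Completeness, Thm. 4.20 (§4.7, p0021)] [cite: Burgisser2004Factors, Thm. 2.2] -/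
theorem borderComplexity_le_approxComplexity (f : MvPolynomial σ ℂ) :
    borderComplexity f ≤ approxComplexity f :=
  borderComplexity_le_of_coeffVec_mem_zariskiClosure f (coeffVec_mem_zariskiClosure_approxComplexity f)

/-- **The tree's two renderings of the border complexity coincide over `ℂ`**: BLMW's
`\underline{L}(f)` (Def. 9.3.1, Zariski closure of `{L ≤ r}` in coefficient space — equivalently the
Euclidean closure, Bürgisser 2024 Thm. 4.19) equals Bürgisser's / CKRST's approximative complexity
(a fan-in-two circuit over `ℂ((ε))` computing `f + O(ε)`; Bürgisser 2024 Thm. 4.20, Alder 1984).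
[cite: Burgisser2024Completeness, Def. 4.18, Thm. 4.19, Thm. 4.20 (§4.7, p0021)] [cite: Burgisser2004Factors, Thm. 2.2] [cite: BurgisserEtAl2011, Def. 9.3.1 (remark following it)] -/
theorem approxComplexity_eq_borderComplexity (f : MvPolynomial σ ℂ) :
    approxComplexity f = borderComplexity f :=
  le_antisymm (approxComplexity_le_borderComplexity f) (borderComplexity_le_approxComplexity f)

/-- **Bürgisser 2024, Def. 4.23 / BLMW 2011 §9.3: the class `\overline{VP}`** in the tree's two
currencies agree — a family is in BLMW's `\overline{VP}` (`IsVPBarFamily`: `\underline{L}(f_n)`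
polynomially bounded) iff its approximative complexities `borderComplexity (f n)` are polynomially
bounded (Bürgisser's `\underline{VP}` of [buerg:04], degree bound aside).
[cite: Burgisser2024Completeness, Def. 4.23 (§4.7, p0021)] [cite: BurgisserEtAl2011, §9.3 (closure of VP)] -/
theorem isVPBarFamily_iff_isPBounded_borderComplexity {v : ℕ → Type*} [∀ n, Fintype (v n)]
    [∀ n, DecidableEq (v n)] (f : ∀ n, MvPolynomial (v n) ℂ) :
    IsVPBarFamily f ↔ IsPBounded fun n => borderComplexity (f n) := by
  have h : (fun n => approxComplexity (f n)) = fun n => borderComplexity (f n) :=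
    funext fun n => approxComplexity_eq_borderComplexity (f n)
  rw [IsVPBarFamily, h]

end Complex

end Literature.Computability.AlgebraicComplexity

end
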